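import Literature.NumberTheory.CubicFields.CubicFieldDiscriminant1727
import Literature.NumberTheory.CubicFields.CubicFieldDiscriminant4827
import HarnessLib

/-!
# The cubic field of discriminant `−1727` (LMFDB 3.1.1727.1), part 2: the primes of norm `≤ 11` are principal — `2 = π_A π_B π_C` by three PRIME
# ELEMENTS (no residue map at `2` exists through a generator), `3, 7` inert, `5 = 𝔮𝔮′`, `11 = 𝔮₄𝔮₉²` — and CLASS NUMBER ONE — PROVED

Sequel of `CubicFieldDiscriminant1727.lean` (same seat `bsd-line-att-p3` g55, same namespace `Literature.NumberTheory.CubicFields.CubicDisc1727`; part 1: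
`f = X³ − X − 16`, `δ = (θ² + θ)/2`, `𝓞_F = ℤ ⊕ ℤθ ⊕ ℤδ`, the norm form `norm_lin3`, `d_F = −1727`, signature).  THEOREMS ONLY; every statement PROVED.
§3: `2` is TOTALLY SPLIT and `2` divides the index of every element of `𝓞_F`, so Dedekind–Kummer cannot be used at `2`; instead three elements
`π_A = 18 + 5θ + 6δ`, `π_B = 3 + θ + δ`, `π_C = 3 + 8θ − 5δ` of norm `2` (hence PRIME, `MonicCubic.prime_of_natAbs_norm_prime` + `norm_lin3`) satisfy
`π_A π_B π_C = 2`, so every prime above `2` is one of the `(π_j)` (`MonicCubic.eq_span_singleton_of_prod_mem`).  `3` and `7` are inert (no root),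
`(5, θ + 3) = (15 − 2θ − 2δ)` (the degree-two prime above `5` has norm `25 > 11`), `(11, θ + 7) = (101 + 24θ − 34δ)`, `(11, θ + 2) = (1 − 4θ + 2δ)`
(`11 = 𝔮₄𝔮₉²` ramified) — Dedekind–Kummer through `θ` (`p ≠ 2`) with EXPLICIT GENERATORS on `(1, θ, δ)`; each ideal identity is two memberships and one
pair-membership checked in `F` by `linear_combination` against `f(α) = 0` with `δ = (α² + α)/2`.
§4: ★ `h_F = 1` by Minkowski (`(4/π)(3!/3³)√1727 ≈ 11.76 < 12`, Mathlib's `RingOfIntegers.isPrincipalIdealRing_of_isPrincipal_of_pow_le_of_mem_primesOver_of_mem_Icc`)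
and `not_two_dvd_classNumber` — the `2 ∤ h(ℚ(β))` datum of the cell's `2`-adic doors for the split-stratum seeds `1727a1`, `29359b1`, `29359d1` of crux C2's
census (cell `bsd-f1-sign2`, route `AlignedTransportAtTwo`; numerically `Cl(F) = 1`, `Cl(F(√2)) ≅ (ℤ/2)²`, `Cl(F·ℚ(ζ₁₆)⁺) ≅ ℤ/4 × ℤ/2`).

References: [LMFDB] number field 3.1.1727.1 (class number 1); [Marcus2018] Ch. 3 Thm. 27, Ch. 5 Thm. 37 and Cor. 2; [Dedekind1878] §5.
-/

noncomputable section

open Polynomial NumberField NumberField.InfinitePlace Ideal Module Real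
open Literature.NumberTheory.NumberFields
open Literature.NumberTheory.NumberFields.MonicCubic

namespace Literature.NumberTheory.CubicFields.CubicDisc1727

section NumberField

variable {F : Type*} [Field F] [NumberField F] {α : F}

/-! ## §3 The primes of norm `≤ 11` are principal -/

/-- `N(π_A) = 2` for `π_A = 18 + 5θ + 6δ` (norm form). [cite: Marcus2018, Ch. 2, Thm. 4] [cite: Dedekind1878, §5] -/
theorem norm_piA (h3 : finrank ℚ F = 3) (hα : aeval α (poly 0 (-1) (-16)) = 0) :
    Algebra.norm ℤ ((18 : 𝓞 F) + 5 * thetaInt hα + 6 * thetaInt (delta_root hα)) = 2 := by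
  have h := norm_lin3 h3 hα 18 5 6
  push_cast at h
  exact h.trans (by norm_num)

/-- `N(π_B) = 2` for `π_B = 3 + θ + δ` (norm form). [cite: Marcus2018, Ch. 2, Thm. 4] [cite: Dedekind1878, §5] -/
theorem norm_piB (h3 : finrank ℚ F = 3) (hα : aeval α (poly 0 (-1) (-16)) = 0) :
    Algebra.norm ℤ ((3 : 𝓞 F) + thetaInt hα + thetaInt (delta_root hα)) = 2 := by
  have h := norm_lin3 h3 hα 3 1 1
  push_cast at h
  rw [one_mul, one_mul] at h
  exact h.trans (by norm_num)

/-- `N(π_C) = 2` for `π_C = 3 + 8θ − 5δ` (norm form). [cite: Marcus2018, Ch. 2, Thm. 4] [cite: Dedekind1878, §5] -/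
theorem norm_piC (h3 : finrank ℚ F = 3) (hα : aeval α (poly 0 (-1) (-16)) = 0) :
    Algebra.norm ℤ ((3 : 𝓞 F) + 8 * thetaInt hα + (-5) * thetaInt (delta_root hα)) = 2 := by
  have h := norm_lin3 h3 hα 3 8 (-5)
  push_cast at h
  exact h.trans (by norm_num)

/-- `π_A = 18 + 5θ + 6δ` is a prime element (norm `2`). [cite: Marcus2018, Ch. 3, Thm. 27] [cite: Dedekind1878, §5] -/
theorem prime_piA (h3 : finrank ℚ F = 3) (hα : aeval α (poly 0 (-1) (-16)) = 0) :
    Prime ((18 : 𝓞 F) + 5 * thetaInt hα + 6 * thetaInt (delta_root hα)) :=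
  prime_of_natAbs_norm_prime (by rw [norm_piA h3 hα]; norm_num)

/-- `π_B = 3 + θ + δ` is a prime element (norm `2`). [cite: Marcus2018, Ch. 3, Thm. 27] [cite: Dedekind1878, §5] -/
theorem prime_piB (h3 : finrank ℚ F = 3) (hα : aeval α (poly 0 (-1) (-16)) = 0) :
    Prime ((3 : 𝓞 F) + thetaInt hα + thetaInt (delta_root hα)) :=
  prime_of_natAbs_norm_prime (by rw [norm_piB h3 hα]; norm_num)

/-- `π_C = 3 + 8θ − 5δ` is a prime element (norm `2`). [cite: Marcus2018, Ch. 3, Thm. 27] [cite: Dedekind1878, §5] -/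
theorem prime_piC (h3 : finrank ℚ F = 3) (hα : aeval α (poly 0 (-1) (-16)) = 0) :
    Prime ((3 : 𝓞 F) + 8 * thetaInt hα + (-5) * thetaInt (delta_root hα)) :=
  prime_of_natAbs_norm_prime (by rw [norm_piC h3 hα]; norm_num)

/-- **`π_A · π_B · π_C = 2`**: the prime `2` is totally split, `(2) = 𝔭_A 𝔭_B 𝔭_C` with three PRINCIPAL primes of norm `2` (identity checked in `F`).
[cite: Dedekind1878, §5] [cite: Marcus2018, Ch. 3, Thm. 27] -/
theorem piA_mul_piB_mul_piC (hα : aeval α (poly 0 (-1) (-16)) = 0) :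
    ((18 : 𝓞 F) + 5 * thetaInt hα + 6 * thetaInt (delta_root hα)) * ((3 : 𝓞 F) + thetaInt hα + thetaInt (delta_root hα)) *
      ((3 : 𝓞 F) + 8 * thetaInt hα + (-5) * thetaInt (delta_root hα)) = 2 := by
  rw [RingOfIntegers.ext_iff]
  simp only [map_mul, map_add, map_neg, map_ofNat, MonicCubic.thetaInt, RingOfIntegers.map_mk]
  linear_combination (((-10 : F)) + ((-55 : F) / 2) * α + ((-13 : F)) * α ^ 2 + ((-15 : F) / 4) * α ^ 3) * cubic_eq hα

/-- **Every prime of `𝓞_F` above `2` is principal**: it contains `2 = π_A π_B π_C`, a product of three prime elements, so it is one of the `(π_j)`.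
(No Dedekind–Kummer at `2`: every generator of `F` has even index.) [cite: Dedekind1878, §5] [cite: LMFDB, number field 3.1.1727.1 (class number 1)] -/
theorem isPrincipal_of_mem_primesOver_2 (h3 : finrank ℚ F = 3) (hα : aeval α (poly 0 (-1) (-16)) = 0) {P : Ideal (𝓞 F)}
    (hP : P ∈ primesOver (span {((2 : ℕ) : ℤ)}) (𝓞 F)) : Submodule.IsPrincipal P := by
  have principal_of_eq : ∀ {x : 𝓞 F}, P = span {x} → Submodule.IsPrincipal P := fun h =>
    ⟨⟨_, by rw [h, submodule_span_eq]⟩⟩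
  have h2 : (((2 : ℕ) : ℤ) : 𝓞 F) ∈ P := by
    have hu : ((2 : ℕ) : ℤ) ∈ P.under ℤ := by
      rw [← hP.2.over]; exact Ideal.mem_span_singleton_self _
    exact hu
  have hmem : ((18 : 𝓞 F) + 5 * thetaInt hα + 6 * thetaInt (delta_root hα)) * ((3 : 𝓞 F) + thetaInt hα + thetaInt (delta_root hα)) *
      ((3 : 𝓞 F) + 8 * thetaInt hα + (-5) * thetaInt (delta_root hα)) ∈ P := by
    rw [piA_mul_piB_mul_piC hα]
    simpa using h2
  rcases eq_span_singleton_of_prod_mem hP.1 (prime_piA h3 hα) (prime_piB h3 hα) (prime_piC h3 hα) hmem with h | h | h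
  · exact principal_of_eq h
  · exact principal_of_eq h
  · exact principal_of_eq h

/-- **Every prime of `𝓞_F` above `3` is principal**: `3` is inert (`f` irreducible mod `3`, `3 ∤ exponent`), so `P = (3)`.
[cite: Marcus2018, Ch. 3, Thm. 27] [cite: LMFDB, number field 3.1.1727.1 (class number 1)] -/
theorem isPrincipal_of_mem_primesOver_3 (h3 : finrank ℚ F = 3) (hα : aeval α (poly 0 (-1) (-16)) = 0) {P : Ideal (𝓞 F)}
    (hP : P ∈ primesOver (span {((3 : ℕ) : ℤ)}) (𝓞 F)) : Submodule.IsPrincipal P := by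
  have hPeq := eq_span_of_no_root' irreducible_polyQ hα (by norm_num : Nat.Prime 3)
    (not_dvd_exponent h3 hα (by norm_num) (by norm_num)) hP no_root_3
  exact ⟨⟨((3 : ℕ) : 𝓞 F), by rw [hPeq, Ideal.submodule_span_eq]⟩⟩

/-- `(5, θ + 3) = (15 - 2θ - 2δ)`, an element of norm `5` (identities checked in `F`, `δ = (α² + α)/2`). [cite: Marcus2018, Ch. 3, Thm. 27] -/
theorem span_5_lin3_eq (hα : aeval α (poly 0 (-1) (-16)) = 0) :
    span {(5 : 𝓞 F), thetaInt hα + 3} = span {15 - 2 * thetaInt hα - 2 * thetaInt (delta_root hα)} := by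
  apply le_antisymm
  · rw [span_le]
    rintro x hx
    rcases hx with rfl | hx
    · exact mem_span_singleton'.mpr ⟨139 + 38 * thetaInt hα + 46 * thetaInt (delta_root hα), by
          rw [RingOfIntegers.ext_iff]
          simp only [map_mul, map_add, map_sub, map_ofNat, MonicCubic.thetaInt, RingOfIntegers.map_mk]
          linear_combination (((-130 : F)) + ((-23 : F)) * α) * cubic_eq hα⟩
    · rw [Set.mem_singleton_iff.mp hx]
      exact mem_span_singleton'.mpr ⟨157 + 43 * thetaInt hα + 52 * thetaInt (delta_root hα), by
          rw [RingOfIntegers.ext_iff]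
          simp only [map_mul, map_add, map_sub, map_ofNat, MonicCubic.thetaInt, RingOfIntegers.map_mk]
          linear_combination (((-147 : F)) + ((-26 : F)) * α) * cubic_eq hα⟩
  · rw [span_singleton_le_iff_mem, mem_span_pair]
    exact ⟨-47 - 26 * thetaInt (delta_root hα), -2 + 32 * thetaInt (delta_root hα), by
        rw [RingOfIntegers.ext_iff]
        simp only [map_mul, map_add, map_sub, map_neg, map_ofNat, MonicCubic.thetaInt, RingOfIntegers.map_mk]
        linear_combination (((16 : F))) * cubic_eq hα⟩

/-- **Every prime of `𝓞_F` above `5` with `5^f ≤ 11` is principal** (Dedekind–Kummer through `θ`, `5 ∤ exponent`, with `polyMod_5`; the degree-two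
prime has norm `25`). [cite: Marcus2018, Ch. 3, Thm. 27] [cite: LMFDB, number field 3.1.1727.1 (class number 1)] -/
theorem isPrincipal_of_mem_primesOver_5 (h3 : finrank ℚ F = 3) (hα : aeval α (poly 0 (-1) (-16)) = 0) {P : Ideal (𝓞 F)}
    (hP : P ∈ primesOver (span {((5 : ℕ) : ℤ)}) (𝓞 F))
    (hle : 5 ^ P.inertiaDeg ℤ ≤ 11) : Submodule.IsPrincipal P := by
  haveI : Fact (Nat.Prime 5) := ⟨by norm_num⟩
  obtain ⟨Qb, hirr, hmon, hdvd, hdeg, hspan⟩ :=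
    exists_factor_of_mem_primesOver' irreducible_polyQ hα (by norm_num : Nat.Prime 5)
      (not_dvd_exponent h3 hα (by norm_num) (by norm_num)) hP
  rw [polyMod_5] at hdvd
  rcases hirr.prime.dvd_or_dvd hdvd with h | h
  · have hirr1 : Irreducible (X + 3 : (ZMod 5)[X]) := by
      rw [show (X + 3 : (ZMod 5)[X]) = X - C (-3) by rw [map_neg, map_ofNat]; ring]
      exact irreducible_X_sub_C _
    have hQb : Qb = X + 3 := eq_of_monic_of_associated hmon (by monicity!) (hirr.associated_of_dvd hirr1 h)
    have hPeq := hspan (X + C 3) (by rw [hQb]; simp [map_ofNat])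
    rw [show aeval (thetaInt hα) (X + C 3 : ℤ[X]) = thetaInt hα + 3 by
        simp only [map_add, aeval_X, aeval_C, algebraMap_int_eq, Int.coe_castRingHom, Int.cast_ofNat], Nat.cast_ofNat, span_5_lin3_eq hα] at hPeq
    exact ⟨⟨15 - 2 * thetaInt hα - 2 * thetaInt (delta_root hα), by rw [hPeq, Ideal.submodule_span_eq]⟩⟩
  · have hQb : Qb = X ^ 2 + 2 * X + 3 :=
      eq_of_monic_of_associated hmon (by monicity!) (hirr.associated_of_dvd CubicDisc4827.irreducible_quad_5 h)
    exfalso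
    have hd2 : (X ^ 2 + 2 * X + 3 : (ZMod 5)[X]).natDegree = 2 := by compute_degree!
    rw [hdeg, hQb, hd2] at hle
    norm_num at hle

/-- **Every prime of `𝓞_F` above `7` is principal**: `7` is inert (`f` irreducible mod `7`, `7 ∤ exponent`), so `P = (7)`.
[cite: Marcus2018, Ch. 3, Thm. 27] [cite: LMFDB, number field 3.1.1727.1 (class number 1)] -/
theorem isPrincipal_of_mem_primesOver_7 (h3 : finrank ℚ F = 3) (hα : aeval α (poly 0 (-1) (-16)) = 0) {P : Ideal (𝓞 F)}
    (hP : P ∈ primesOver (span {((7 : ℕ) : ℤ)}) (𝓞 F)) : Submodule.IsPrincipal P := by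
  have hPeq := eq_span_of_no_root' irreducible_polyQ hα (by norm_num : Nat.Prime 7)
    (not_dvd_exponent h3 hα (by norm_num) (by norm_num)) hP no_root_7
  exact ⟨⟨((7 : ℕ) : 𝓞 F), by rw [hPeq, Ideal.submodule_span_eq]⟩⟩

/-- `(11, θ + 7) = (101 + 24θ - 34δ)`, an element of norm `11` (identities checked in `F`, `δ = (α² + α)/2`). [cite: Marcus2018, Ch. 3, Thm. 27] -/
theorem span_11_lin7_eq (hα : aeval α (poly 0 (-1) (-16)) = 0) :
    span {(11 : 𝓞 F), thetaInt hα + 7} = span {101 + 24 * thetaInt hα - 34 * thetaInt (delta_root hα)} := by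
  apply le_antisymm
  · rw [span_le]
    rintro x hx
    rcases hx with rfl | hx
    · exact mem_span_singleton'.mpr ⟨8911 + 2440 * thetaInt hα + 2954 * thetaInt (delta_root hα), by
          rw [RingOfIntegers.ext_iff]
          simp only [map_mul, map_add, map_sub, map_ofNat, MonicCubic.thetaInt, RingOfIntegers.map_mk]
          linear_combination (((-56250 : F)) + ((-25109 : F)) * α) * cubic_eq hα⟩
    · rw [Set.mem_singleton_iff.mp hx]
      exact mem_span_singleton'.mpr ⟨7819 + 2141 * thetaInt hα + 2592 * thetaInt (delta_root hα), by
          rw [RingOfIntegers.ext_iff]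
          simp only [map_mul, map_add, map_sub, map_ofNat, MonicCubic.thetaInt, RingOfIntegers.map_mk]
          linear_combination (((-49357 : F)) + ((-22032 : F)) * α) * cubic_eq hα⟩
  · rw [span_singleton_le_iff_mem, mem_span_pair]
    exact ⟨500 - 125 * thetaInt hα + 1378 * thetaInt (delta_root hα), 1399 - 1899 * thetaInt (delta_root hα), by
        rw [RingOfIntegers.ext_iff]
        simp only [map_mul, map_add, map_sub, map_ofNat, MonicCubic.thetaInt, RingOfIntegers.map_mk]
        linear_combination (((-1899 : F) / 2)) * cubic_eq hα⟩

/-- `(11, θ + 2) = (1 - 4θ + 2δ)`, an element of norm `11` — the ramified prime `𝔮₉` (`𝔮₉² ∥ 11`) (identities checked in `F`, `δ = (α² + α)/2`).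
[cite: Marcus2018, Ch. 3, Thm. 27] -/
theorem span_11_lin2_eq (hα : aeval α (poly 0 (-1) (-16)) = 0) :
    span {(11 : 𝓞 F), thetaInt hα + 2} = span {1 - 4 * thetaInt hα + 2 * thetaInt (delta_root hα)} := by
  apply le_antisymm
  · rw [span_le]
    rintro x hx
    rcases hx with rfl | hx
    · exact mem_span_singleton'.mpr ⟨43 + 12 * thetaInt hα + 14 * thetaInt (delta_root hα), by
          rw [RingOfIntegers.ext_iff]
          simp only [map_mul, map_add, map_sub, map_ofNat, map_one, MonicCubic.thetaInt, RingOfIntegers.map_mk]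
          linear_combination (((-2 : F)) + ((7 : F)) * α) * cubic_eq hα⟩
    · rw [Set.mem_singleton_iff.mp hx]
      exact mem_span_singleton'.mpr ⟨18 + 5 * thetaInt hα + 6 * thetaInt (delta_root hα), by
          rw [RingOfIntegers.ext_iff]
          simp only [map_mul, map_add, map_sub, map_ofNat, map_one, MonicCubic.thetaInt, RingOfIntegers.map_mk]
          linear_combination (((-1 : F)) + ((3 : F)) * α) * cubic_eq hα⟩
  · rw [span_singleton_le_iff_mem, mem_span_pair]
    exact ⟨1, -5 + thetaInt hα, by
        rw [RingOfIntegers.ext_iff]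
        simp only [map_mul, map_add, map_sub, map_neg, map_ofNat, map_one, MonicCubic.thetaInt, RingOfIntegers.map_mk]
        linear_combination (0 : F) * cubic_eq hα⟩

/-- **Every prime of `𝓞_F` above `11` is principal** (Dedekind–Kummer through `θ`, `11 ∤ exponent`, with `polyMod_11 = (X + 7)(X + 2)²` and the two
generators above). [cite: Marcus2018, Ch. 3, Thm. 27] [cite: LMFDB, number field 3.1.1727.1 (class number 1)] -/
theorem isPrincipal_of_mem_primesOver_11 (h3 : finrank ℚ F = 3) (hα : aeval α (poly 0 (-1) (-16)) = 0) {P : Ideal (𝓞 F)}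
    (hP : P ∈ primesOver (span {((11 : ℕ) : ℤ)}) (𝓞 F)) : Submodule.IsPrincipal P := by
  haveI : Fact (Nat.Prime 11) := ⟨by norm_num⟩
  obtain ⟨Qb, hirr, hmon, hdvd, -, hspan⟩ :=
    exists_factor_of_mem_primesOver' irreducible_polyQ hα (by norm_num : Nat.Prime 11)
      (not_dvd_exponent h3 hα (by norm_num) (by norm_num)) hP
  rw [polyMod_11] at hdvd
  have case2 : Qb ∣ (X + 2 : (ZMod 11)[X]) → Submodule.IsPrincipal P := fun h => by
    have hirr1 : Irreducible (X + 2 : (ZMod 11)[X]) := by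
      rw [show (X + 2 : (ZMod 11)[X]) = X - C (-2) by rw [map_neg, map_ofNat]; ring]
      exact irreducible_X_sub_C _
    have hQb : Qb = X + 2 := eq_of_monic_of_associated hmon (by monicity!) (hirr.associated_of_dvd hirr1 h)
    have hPeq := hspan (X + C 2) (by rw [hQb]; simp [map_ofNat])
    rw [show aeval (thetaInt hα) (X + C 2 : ℤ[X]) = thetaInt hα + 2 by
        simp only [map_add, aeval_X, aeval_C, algebraMap_int_eq, Int.coe_castRingHom, Int.cast_ofNat], Nat.cast_ofNat, span_11_lin2_eq hα] at hPeq
    exact ⟨⟨1 - 4 * thetaInt hα + 2 * thetaInt (delta_root hα), by rw [hPeq, Ideal.submodule_span_eq]⟩⟩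
  rcases hirr.prime.dvd_or_dvd hdvd with h12 | h
  · rcases hirr.prime.dvd_or_dvd h12 with h | h
    · have hirr1 : Irreducible (X + 7 : (ZMod 11)[X]) := by
        rw [show (X + 7 : (ZMod 11)[X]) = X - C (-7) by rw [map_neg, map_ofNat]; ring]
        exact irreducible_X_sub_C _
      have hQb : Qb = X + 7 := eq_of_monic_of_associated hmon (by monicity!) (hirr.associated_of_dvd hirr1 h)
      have hPeq := hspan (X + C 7) (by rw [hQb]; simp [map_ofNat])
      rw [show aeval (thetaInt hα) (X + C 7 : ℤ[X]) = thetaInt hα + 7 by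
          simp only [map_add, aeval_X, aeval_C, algebraMap_int_eq, Int.coe_castRingHom, Int.cast_ofNat], Nat.cast_ofNat, span_11_lin7_eq hα] at hPeq
      exact ⟨⟨101 + 24 * thetaInt hα - 34 * thetaInt (delta_root hα), by rw [hPeq, Ideal.submodule_span_eq]⟩⟩
    · exact case2 h
  · exact case2 h

/-! ## §4 Class number one -/

/-- **`𝓞_F` is a principal ideal domain.**  Minkowski: every ideal class contains an ideal of norm `≤ (4/π)(6/27)√1727 < 12`, and the primes
`P` above `p ≤ 11` with `p^f ≤ 11` are principal (§3). [cite: LMFDB, number field 3.1.1727.1 (class number 1)] [cite: Marcus2018, Ch. 5, Thm. 37 and Cor. 2] -/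
theorem isPrincipalIdealRing (h3 : finrank ℚ F = 3) (hα : aeval α (poly 0 (-1) (-16)) = 0) : IsPrincipalIdealRing (𝓞 F) := by
  apply RingOfIntegers.isPrincipalIdealRing_of_isPrincipal_of_pow_le_of_mem_primesOver_of_mem_Icc
  rw [nrComplexPlaces_eq_one h3 hα, h3, discr_eq h3 hα]
  intro p hp hpr P hP hle
  obtain ⟨hp1, hpM⟩ := Finset.mem_Icc.mp hp
  have hreal : (4 / π) ^ 1 * ((((3 : ℕ).factorial : ℕ) : ℝ) / ((3 : ℕ) : ℝ) ^ (3 : ℕ) * √|((-1727 : ℤ) : ℝ)|) < ((12 : ℕ) : ℝ) := by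
    have hπ := Real.pi_gt_d2
    have hπ0 := Real.pi_pos
    have hs : √(1727 : ℝ) < 41.56 := by
      rw [Real.sqrt_lt' (by norm_num)]; norm_num
    have hs0 : 0 ≤ √(1727 : ℝ) := Real.sqrt_nonneg _
    have habs : |((-1727 : ℤ) : ℝ)| = 1727 := by norm_num
    rw [habs]
    norm_num [Nat.factorial]
    rw [div_mul_eq_mul_div, div_lt_iff₀ hπ0]
    nlinarith
  have hfl := Nat.lt_succ_iff.mp ((Nat.floor_lt' (by norm_num)).mpr hreal)
  have hpB : p ≤ 11 := hpM.trans hfl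
  have hleB : p ^ P.inertiaDeg ℤ ≤ 11 := hle.trans hfl
  clear hpM hle hp
  interval_cases p
  · exact absurd hpr (by norm_num)
  · exact isPrincipal_of_mem_primesOver_2 h3 hα hP
  · exact isPrincipal_of_mem_primesOver_3 h3 hα hP
  · exact absurd hpr (by norm_num)
  · exact isPrincipal_of_mem_primesOver_5 h3 hα hP hleB
  · exact absurd hpr (by norm_num)
  · exact isPrincipal_of_mem_primesOver_7 h3 hα hP
  · exact absurd hpr (by norm_num)
  · exact absurd hpr (by norm_num)
  · exact absurd hpr (by norm_num)
  · exact isPrincipal_of_mem_primesOver_11 h3 hα hP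

/-- ★ **`h_F = 1`: the cubic field of discriminant `−1727` has class number one** (`𝓞_F = ℤ ⊕ ℤθ ⊕ ℤδ`; no power integral basis exists).
[cite: LMFDB, number field 3.1.1727.1 (class number 1)] -/
theorem classNumber_eq_one (h3 : finrank ℚ F = 3) (hα : aeval α (poly 0 (-1) (-16)) = 0) : classNumber F = 1 :=
  (classNumber_eq_one_iff (K := F)).mpr (isPrincipalIdealRing h3 hα)

/-- **`h_F` is odd** (the form consumed by the `2`-adic doors of cell `bsd-f1-sign2`). [cite: LMFDB, number field 3.1.1727.1 (class number 1)] -/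
theorem not_two_dvd_classNumber (h3 : finrank ℚ F = 3) (hα : aeval α (poly 0 (-1) (-16)) = 0) : ¬ 2 ∣ classNumber F := by
  rw [classNumber_eq_one h3 hα]; decide

end NumberField

end Literature.NumberTheory.CubicFields.CubicDisc1727

end
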